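import Summits.BirchSwinnertonDyer.BirchSwinnertonDyer.Theorems.ClassRecordThreeRegCertKernelLog
import HarnessLib

/-!
# Route `ClassRecordThree`, crux `SchneiderAtThree` (item 19106): the unit part of `Y = C²·σ_q²(ch w)` at depth `K` to
# precision `3⁻ᴺ` — the pure `3`-adic estimate of the precision-parametrised deep REG3CERT kernel checker
# (cell `bsd-stepL`, seat `bsd-stepL-reg3-eng` g4; `--supports stmt-BirchSwinnertonDyer-19106`)

HONEST FRAMING: BSD is not proved by any of this; nothing here closes the crux; Schneider's non-degeneracy conjecture
(barrier `PAdicHeightNondegeneracy`) is asserted NOWHERE; every application is ONE curve. With `P = 3^{2K}`,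
`Λ = log_Ŵ(z)/3ᴷ ≡ λ (mod 3ᴺ)`, `C² ≡ Γ (mod 3ᵐ)`, `w = P·Λ²/C²`, `c = ch(w)` to third order, the sigma product `Π` to
first order in `q`, and `q ≡ Δ/c₄³ (mod 3^{2δ})`, `‖q‖ ≤ 3^{−δ}`:
`‖C²·(2(c − 1)Π) − P·υ‖ ≤ ‖P‖·3⁻ᴺ` whenever `3^{N+2} ∣ λ²(360Γ² + 30Pλ²Γ + P²λ⁴)(c₄³Γ − 2PΔλ²) − 360Γ³c₄³υ` and
`1 ≤ m ≤ N`, `N + 2 ≤ 6K`, `N + 1 ≤ m + 2K`, `N ≤ 2δ + 2K`, `N + 1 ≤ δ + 4K` — the scale `C²` cancels at leading order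
(`C²·w = (3ᴷΛ)²`), surviving only in the corrections `w/12`, `w²/360` and in `Π`'s first-order term. All hypotheses are
norm inequalities between elements of `ℚ₃`; the curve enters only through them (`…RegCertKernelUniform` instantiates).

Theorems only (0 defs, 0 facts). References: [SteinWuthrich2013] §4.2; [SilvermanAEC2009] IV.6.
-/

open scoped Classical

open Literature.NumberTheory.EllipticCurves

namespace Summit.BirchSwinnertonDyer.Rank1Residual.X11b.RegMult.KernelCert

/-! ### §0 Plumbing -/

/-- Ultrametric inequality for differences. [folklore] -/
private theorem norm_sub_le_max₇ (a b : ℚ_[3]) : ‖a - b‖ ≤ max ‖a‖ ‖b‖ := by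
  rw [sub_eq_add_neg, ← norm_neg b]; exact IsUltrametricDist.norm_add_le_max a (-b)

/-- `‖3^k‖₃ = 1/3^k`. [folklore] -/
private theorem norm_three_pow (k : ℕ) : ‖(3 : ℚ_[3]) ^ k‖ = 1 / (3 : ℝ) ^ k := by
  rw [norm_pow, show (3 : ℚ_[3]) = ((3 : ℕ) : ℚ_[3]) by norm_cast, Padic.norm_p]; simp

/-- `1/3^l ≤ 1/3^k` for `k ≤ l`. [folklore] -/
private theorem third_pow_le {k l : ℕ} (h : k ≤ l) : 1 / (3 : ℝ) ^ l ≤ 1 / (3 : ℝ) ^ k :=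
  one_div_le_one_div_of_le (by positivity) (pow_le_pow_right₀ (by norm_num) h)

/-- `‖(n : ℚ₃)⁻¹‖ = 1` for an integer `n` prime to `3`. [folklore] -/
private theorem norm_inv_intCast_eq_one {n : ℤ} (h : ¬ (3 : ℤ) ∣ n) : ‖((n : ℚ_[3]))⁻¹‖ = 1 := by
  rw [norm_inv, norm_intCast_eq_one_of_not_dvd h, inv_one]

/-- `‖(12 : ℚ₃)⁻¹‖ = 3`, `‖(360 : ℚ₃)⁻¹‖ = 9`. [folklore] -/
private theorem norm_inv_consts' : ‖(12 : ℚ_[3])⁻¹‖ = 3 ∧ ‖(360 : ℚ_[3])⁻¹‖ = 9 := by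
  have h3 : ‖(3 : ℚ_[3])⁻¹‖ = 3 := by
    rw [norm_inv, show (3 : ℚ_[3]) = ((3 : ℕ) : ℚ_[3]) by norm_cast, Padic.norm_p]; norm_num
  have h9 : ‖(9 : ℚ_[3])⁻¹‖ = 9 := by
    rw [show (9 : ℚ_[3]) = 3 * 3 by norm_num, mul_inv, norm_mul, h3]; norm_num
  refine ⟨?_, ?_⟩
  · rw [show (12 : ℚ_[3]) = ((4 : ℤ) : ℚ_[3]) * 3 by norm_num, mul_inv, norm_mul, norm_inv_intCast_eq_one (by decide),
      h3, one_mul]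
  · rw [show (360 : ℚ_[3]) = ((40 : ℤ) : ℚ_[3]) * 9 by norm_num, mul_inv, norm_mul, norm_inv_intCast_eq_one (by decide),
      h9, one_mul]

/-! ### §1 The unit part of `Y = C²σ²` -/

/-- **The unit part of `Y = C²·σ_q²(ch w)` at depth `K` to precision `3⁻ᴺ`** (pure `3`-adic estimate). With `P = 3^{2K}`,
`Λ = log_Ŵ(z)/3ᴷ ≡ λ`, `C² ≡ Γ (mod 3ᵐ)`, `w = P·Λ²/C²`, `c = ch(w)` known to third order, the sigma product `Π` to first
order in `q`, `q ≡ Δ/c₄³ (mod 3^{2δ})`, `‖q‖ ≤ 3^{−δ}`: `‖C²·(2(c − 1)Π) − P·υ‖ ≤ ‖P‖·3⁻ᴺ` whenever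
`3^{N+2} ∣ λ²(360Γ² + 30Pλ²Γ + P²λ⁴)(c₄³Γ − 2PΔλ²) − 360Γ³c₄³υ` and `m ≤ N`, `N + 2 ≤ 6K`, `N + 1 ≤ m + 2K`,
`N ≤ 2δ + 2K`, `N + 1 ≤ δ + 4K` (the scale `C²` cancels at leading order: `C²·w = (3ᴷΛ)²`). [cite: SteinWuthrich2013, §4.2] -/
theorem norm_unitPart_sub_le {Λ C2 w c Pr q : ℚ_[3]} {lam Γ D c4 ups : ℤ} {K N m δ : ℕ}
    (hK : 1 ≤ K) (hm1 : 1 ≤ m) (hmN : m ≤ N) (hN6K : N + 2 ≤ 6 * K) (hm : N + 1 ≤ m + 2 * K)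
    (hPa : N ≤ 2 * δ + 2 * K) (hPb : N + 1 ≤ δ + 4 * K)
    (h3lam : ¬ (3 : ℤ) ∣ lam) (h3Γ : ¬ (3 : ℤ) ∣ Γ) (h3c4 : ¬ (3 : ℤ) ∣ c4) (hδ : (3 : ℤ) ^ δ ∣ D)
    (hΛ : ‖Λ - lam‖ ≤ 1 / (3 : ℝ) ^ N) (hC : ‖C2 - Γ‖ ≤ 1 / (3 : ℝ) ^ m)
    (hw : w = (3 : ℚ_[3]) ^ (2 * K) * (Λ ^ 2 / C2))
    (hc1 : ‖(c - 1) - w / 2‖ ≤ 3 * ‖w‖ ^ 2) (hc3 : ‖c - 1 - w / 2 - w ^ 2 / 24 - w ^ 3 / 720‖ ≤ 9 * ‖w‖ ^ 4)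
    (hPr : ‖Pr - (1 - 4 * q * (c - 1))‖ ≤ ‖q‖ ^ 2 * ‖c - 1‖)
    (hq : ‖q‖ ≤ 1 / (3 : ℝ) ^ δ) (hqD : ‖q - (D : ℚ_[3]) / (c4 : ℚ_[3]) ^ 3‖ ≤ 1 / (3 : ℝ) ^ (2 * δ))
    (hups : (3 : ℤ) ^ (N + 2) ∣ lam ^ 2 * (360 * Γ ^ 2 + 30 * 3 ^ (2 * K) * lam ^ 2 * Γ + 3 ^ (4 * K) * lam ^ 4) *
      (c4 ^ 3 * Γ - 2 * 3 ^ (2 * K) * D * lam ^ 2) - 360 * Γ ^ 3 * c4 ^ 3 * ups) :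
    ‖C2 * (2 * (c - 1) * Pr) - (3 : ℚ_[3]) ^ (2 * K) * ups‖ ≤ ‖(3 : ℚ_[3]) ^ (2 * K)‖ / (3 : ℝ) ^ N := by
  obtain ⟨h12n, h360n⟩ := norm_inv_consts'
  set P : ℚ_[3] := (3 : ℚ_[3]) ^ (2 * K) with hP
  have hPn : ‖P‖ = 1 / (3 : ℝ) ^ (2 * K) := norm_three_pow (2 * K)
  have hP0 : P ≠ 0 := pow_ne_zero _ (by norm_num)
  have hlamn : ‖(lam : ℚ_[3])‖ = 1 := norm_intCast_eq_one_of_not_dvd h3lam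
  have hΓn : ‖(Γ : ℚ_[3])‖ = 1 := norm_intCast_eq_one_of_not_dvd h3Γ
  have hc4n : ‖(c4 : ℚ_[3])‖ = 1 := norm_intCast_eq_one_of_not_dvd h3c4
  have hΓ0 : (Γ : ℚ_[3]) ≠ 0 := by intro h; rw [h, norm_zero] at hΓn; exact zero_ne_one hΓn
  have hc40 : (c4 : ℚ_[3]) ≠ 0 := by intro h; rw [h, norm_zero] at hc4n; exact zero_ne_one hc4n
  have hN0 : 1 / (3 : ℝ) ^ N ≤ 1 := (third_pow_le (Nat.zero_le N)).trans (by norm_num)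
  have hm0 : 1 / (3 : ℝ) ^ m ≤ 1 / 3 ∨ m = 0 := by
    rcases Nat.eq_zero_or_pos m with h | h
    · exact Or.inr h
    · exact Or.inl ((third_pow_le h).trans (by norm_num))
  -- `‖Λ‖ = 1`, `‖C2‖ = 1`
  have hΛn : ‖Λ‖ = 1 := by
    rw [← hlamn]
    refine Padic.norm_eq_of_norm_sub_lt_right (hΛ.trans_lt ?_)
    rw [hlamn]
    calc 1 / (3 : ℝ) ^ N ≤ 1 / (3 : ℝ) ^ 1 := third_pow_le (le_trans hm1 hmN)
      _ < 1 := by norm_num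
  have hCn : ‖C2‖ = 1 := by
    rw [← hΓn]
    refine Padic.norm_eq_of_norm_sub_lt_right (hC.trans_lt ?_)
    rw [hΓn]
    calc 1 / (3 : ℝ) ^ m ≤ 1 / (3 : ℝ) ^ 1 := third_pow_le hm1
      _ < 1 := by norm_num
  have hC0 : C2 ≠ 0 := by intro h; rw [h, norm_zero] at hCn; exact zero_ne_one hCn
  -- `w = P·w₁`, `w₁ = Λ²/C2`, `‖w‖ = ‖P‖`
  set w1 : ℚ_[3] := Λ ^ 2 / C2 with hw1
  have hw1n : ‖w1‖ = 1 := by rw [hw1, norm_div, norm_pow, hΛn, hCn]; norm_num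
  have hwn : ‖w‖ = 1 / (3 : ℝ) ^ (2 * K) := by rw [hw, norm_mul, hPn, hw1n, mul_one]
  have hw81 : ‖w‖ ≤ 1 / 9 := by
    rw [hwn]; calc 1 / (3 : ℝ) ^ (2 * K) ≤ 1 / (3 : ℝ) ^ (2 * 1) := third_pow_le (by omega)
      _ = 1 / 9 := by norm_num
  -- the model values `w₁⁰ = λ²/Γ`, `‖w₁ − w₁⁰‖ ≤ 3⁻ᵐ`
  set w10 : ℚ_[3] := (lam : ℚ_[3]) ^ 2 / (Γ : ℚ_[3]) with hw10
  have hw10n : ‖w10‖ = 1 := by rw [hw10, norm_div, norm_pow, hlamn, hΓn]; norm_num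
  have hΛ2 : ‖Λ ^ 2 - (lam : ℚ_[3]) ^ 2‖ ≤ 1 / (3 : ℝ) ^ N := by
    have : Λ ^ 2 - (lam : ℚ_[3]) ^ 2 = (Λ - lam) * (Λ + lam) := by ring
    rw [this, norm_mul]
    have hs : ‖Λ + lam‖ ≤ 1 := (IsUltrametricDist.norm_add_le_max _ _).trans (max_le hΛn.le hlamn.le)
    calc ‖Λ - lam‖ * ‖Λ + lam‖ ≤ 1 / (3 : ℝ) ^ N * 1 := by gcongr
      _ = 1 / (3 : ℝ) ^ N := mul_one _
  have hw1d : ‖w1 - w10‖ ≤ 1 / (3 : ℝ) ^ m := by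
    have hid : w1 - w10 = ((Λ ^ 2 - (lam : ℚ_[3]) ^ 2) * Γ + (lam : ℚ_[3]) ^ 2 * (Γ - C2)) / (C2 * Γ) := by
      rw [hw1, hw10]; field_simp; ring
    rw [hid, norm_div, norm_mul, hCn, hΓn, one_mul, div_one]
    refine (IsUltrametricDist.norm_add_le_max _ _).trans (max_le ?_ ?_)
    · rw [norm_mul, hΓn, mul_one]; exact hΛ2.trans (third_pow_le hmN)
    · rw [norm_mul, norm_pow, hlamn, one_pow, one_mul, ← norm_neg, neg_sub]; exact hC
  -- `c − 1`: norm and the two truncations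
  have h2n : ‖(2 : ℚ_[3])‖ = 1 := by
    rw [show (2 : ℚ_[3]) = ((2 : ℤ) : ℚ_[3]) by norm_cast]; exact norm_intCast_eq_one_of_not_dvd (by decide)
  have h4n : ‖(4 : ℚ_[3])‖ = 1 := by
    rw [show (4 : ℚ_[3]) = ((4 : ℤ) : ℚ_[3]) by norm_cast]; exact norm_intCast_eq_one_of_not_dvd (by decide)
  have hw2 : ‖w / 2‖ = ‖w‖ := by rw [norm_div, h2n, div_one]
  have hwpos : 0 < ‖w‖ := by rw [hwn]; positivity
  have hc1n : ‖c - 1‖ = ‖w‖ := by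
    rw [← hw2]
    refine Padic.norm_eq_of_norm_sub_lt_right (hc1.trans_lt ?_)
    rw [hw2]
    calc 3 * ‖w‖ ^ 2 = (3 * ‖w‖) * ‖w‖ := by ring
      _ < 1 * ‖w‖ := by gcongr; linarith
      _ = ‖w‖ := one_mul _
  have hcn : ‖c‖ ≤ 1 := by
    have : c = (c - 1) + 1 := by ring
    rw [this]
    refine (IsUltrametricDist.norm_add_le_max _ _).trans (max_le ?_ (by rw [norm_one]))
    rw [hc1n]; linarith
  -- the Tate side: `‖t‖ ≤ 3^{−δ}`, `t = Δ/c₄³`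
  set t : ℚ_[3] := (D : ℚ_[3]) / (c4 : ℚ_[3]) ^ 3 with ht
  have htn : ‖t‖ ≤ 1 / (3 : ℝ) ^ δ := by
    rw [ht, norm_div, norm_pow, hc4n, one_pow, div_one]; exact norm_intCast_le_of_pow_dvd hδ
  have hq1 : ‖q‖ ≤ 1 := hq.trans ((third_pow_le (Nat.zero_le δ)).trans (by norm_num))
  have ht1 : ‖t‖ ≤ 1 := htn.trans ((third_pow_le (Nat.zero_le δ)).trans (by norm_num))
  -- `Π`: norm ≤ 1 and the model value `Π⁰ = 1 − 2tPw₁⁰`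
  have hPr1 : ‖Pr‖ ≤ 1 := by
    have : Pr = (Pr - (1 - 4 * q * (c - 1))) + (1 - 4 * q * (c - 1)) := by ring
    rw [this]
    refine (IsUltrametricDist.norm_add_le_max _ _).trans (max_le (hPr.trans ?_) ?_)
    · calc ‖q‖ ^ 2 * ‖c - 1‖ ≤ 1 ^ 2 * 1 := by
            gcongr
            rw [hc1n]; exact hw81.trans (by norm_num)
        _ = 1 := by norm_num
    · refine (norm_sub_le_max₇ _ _).trans (max_le (by rw [norm_one]) ?_)
      rw [norm_mul, norm_mul, h4n, one_mul, hc1n]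
      calc ‖q‖ * ‖w‖ ≤ 1 * 1 := by gcongr; exact hw81.trans (by norm_num)
        _ = 1 := mul_one _
  set Pr0 : ℚ_[3] := 1 - 2 * t * P * w10 with hPr0
  have hPrd : ‖Pr - Pr0‖ ≤ 1 / (3 : ℝ) ^ N := by
    have hid : Pr - Pr0 = (Pr - (1 - 4 * q * (c - 1))) + (-(4 * (q - t) * (c - 1))) +
        (-(4 * t * ((c - 1) - w / 2))) + (-(2 * t * P * (w1 - w10))) := by
      rw [hPr0, hw]; ring
    rw [hid]
    have hb1 : ‖Pr - (1 - 4 * q * (c - 1))‖ ≤ 1 / (3 : ℝ) ^ N := by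
      refine hPr.trans ?_
      rw [hc1n, hwn]
      calc ‖q‖ ^ 2 * (1 / (3 : ℝ) ^ (2 * K)) ≤ (1 / (3 : ℝ) ^ δ) ^ 2 * (1 / (3 : ℝ) ^ (2 * K)) := by gcongr
        _ = 1 / (3 : ℝ) ^ (2 * δ + 2 * K) := by rw [div_pow, one_pow, ← pow_mul, pow_add]; field_simp; ring
        _ ≤ 1 / (3 : ℝ) ^ N := third_pow_le hPa
    have hb2 : ‖-(4 * (q - t) * (c - 1))‖ ≤ 1 / (3 : ℝ) ^ N := by
      rw [norm_neg, norm_mul, norm_mul, h4n, one_mul, hc1n, hwn]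
      calc ‖q - t‖ * (1 / (3 : ℝ) ^ (2 * K)) ≤ 1 / (3 : ℝ) ^ (2 * δ) * (1 / (3 : ℝ) ^ (2 * K)) := by gcongr
        _ = 1 / (3 : ℝ) ^ (2 * δ + 2 * K) := by rw [pow_add]; field_simp
        _ ≤ 1 / (3 : ℝ) ^ N := third_pow_le hPa
    have hb3 : ‖-(4 * t * ((c - 1) - w / 2))‖ ≤ 1 / (3 : ℝ) ^ N := by
      rw [norm_neg, norm_mul, norm_mul, h4n, one_mul]
      calc ‖t‖ * ‖(c - 1) - w / 2‖ ≤ 1 / (3 : ℝ) ^ δ * (3 * ‖w‖ ^ 2) := by gcongr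
        _ = 1 / (3 : ℝ) ^ δ * (3 * (1 / (3 : ℝ) ^ (2 * K)) ^ 2) := by rw [hwn]
        _ = 1 / (3 : ℝ) ^ (δ + 4 * K - 1) := by
            have h4K : δ + 4 * K - 1 + 1 = δ + 4 * K := by omega
            have : (3 : ℝ) ^ (δ + 4 * K) = (3 : ℝ) ^ (δ + 4 * K - 1) * 3 := by rw [← pow_succ, h4K]
            rw [div_pow, one_pow, ← pow_mul, show 2 * K * 2 = 4 * K by ring]
            field_simp
            rw [show (3 : ℝ) ^ δ * (3 : ℝ) ^ (4 * K) = (3 : ℝ) ^ (δ + 4 * K) by rw [pow_add], this]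
            ring
        _ ≤ 1 / (3 : ℝ) ^ N := third_pow_le (by omega)
    have hb4 : ‖-(2 * t * P * (w1 - w10))‖ ≤ 1 / (3 : ℝ) ^ N := by
      rw [norm_neg, norm_mul, norm_mul, norm_mul, h2n, one_mul, hPn]
      calc ‖t‖ * (1 / (3 : ℝ) ^ (2 * K)) * ‖w1 - w10‖
          ≤ 1 / (3 : ℝ) ^ δ * (1 / (3 : ℝ) ^ (2 * K)) * (1 / (3 : ℝ) ^ m) := by gcongr
        _ = 1 / (3 : ℝ) ^ (δ + 2 * K + m) := by rw [pow_add, pow_add]; field_simp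
        _ ≤ 1 / (3 : ℝ) ^ N := third_pow_le (by omega)
    refine (IsUltrametricDist.norm_add_le_max _ _).trans (max_le ?_ hb4)
    refine (IsUltrametricDist.norm_add_le_max _ _).trans (max_le ?_ hb3)
    exact (IsUltrametricDist.norm_add_le_max _ _).trans (max_le hb1 hb2)
  have hPr0n : ‖Pr0‖ ≤ 1 := by
    rw [hPr0]
    refine (norm_sub_le_max₇ _ _).trans (max_le (by rw [norm_one]) ?_)
    rw [norm_mul, norm_mul, norm_mul, h2n, one_mul, hw10n, mul_one]
    calc ‖t‖ * ‖P‖ ≤ 1 * 1 := by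
          gcongr
          rw [hPn]; exact (third_pow_le (Nat.zero_le _)).trans (by norm_num)
      _ = 1 := mul_one _
  -- `S₂ = 1 + w/12 + w²/360` and its model value
  set S2 : ℚ_[3] := 1 + w / 12 + w ^ 2 / 360 with hS2
  set S20 : ℚ_[3] := 1 + P * w10 / 12 + (P * w10) ^ 2 / 360 with hS20
  have hPw : ‖P * w10‖ ≤ 1 / 9 := by rw [norm_mul, hw10n, mul_one, hPn, ← hwn]; exact hw81
  have hS2aux : ∀ u : ℚ_[3], ‖u‖ ≤ 1 / 9 → ‖1 + u / 12 + u ^ 2 / 360‖ ≤ 1 := by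
    intro u hu
    refine (IsUltrametricDist.norm_add_le_max _ _).trans (max_le ?_ ?_)
    · refine (IsUltrametricDist.norm_add_le_max _ _).trans (max_le (by rw [norm_one]) ?_)
      rw [div_eq_mul_inv, norm_mul, h12n]
      calc ‖u‖ * 3 ≤ 1 / 9 * 3 := by gcongr
        _ ≤ 1 := by norm_num
    · rw [div_eq_mul_inv, norm_mul, h360n, norm_pow]
      calc ‖u‖ ^ 2 * 9 ≤ (1 / 9) ^ 2 * 9 := by gcongr
        _ ≤ 1 := by norm_num
  have hS2n : ‖S2‖ ≤ 1 := hS2aux w hw81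
  have hS20n : ‖S20‖ ≤ 1 := hS2aux (P * w10) hPw
  have hS2d : ‖S2 - S20‖ ≤ 1 / (3 : ℝ) ^ N := by
    have hid : S2 - S20 = P * (w1 - w10) / 12 + P ^ 2 * ((w1 - w10) * (w1 + w10)) / 360 := by
      rw [hS2, hS20, hw]; ring
    rw [hid]
    have hs : ‖w1 + w10‖ ≤ 1 := (IsUltrametricDist.norm_add_le_max _ _).trans (max_le hw1n.le hw10n.le)
    refine (IsUltrametricDist.norm_add_le_max _ _).trans (max_le ?_ ?_)
    · rw [div_eq_mul_inv, norm_mul, norm_mul, h12n, hPn]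
      calc 1 / (3 : ℝ) ^ (2 * K) * ‖w1 - w10‖ * 3 ≤ 1 / (3 : ℝ) ^ (2 * K) * (1 / (3 : ℝ) ^ m) * 3 := by gcongr
        _ = 1 / (3 : ℝ) ^ (2 * K + m - 1) := by
            have h1 : 2 * K + m - 1 + 1 = 2 * K + m := by omega
            have : (3 : ℝ) ^ (2 * K + m) = (3 : ℝ) ^ (2 * K + m - 1) * 3 := by rw [← pow_succ, h1]
            rw [show (1 : ℝ) / (3 : ℝ) ^ (2 * K) * (1 / (3 : ℝ) ^ m) = 1 / (3 : ℝ) ^ (2 * K + m) by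
              rw [pow_add]; field_simp, this]
            field_simp
        _ ≤ 1 / (3 : ℝ) ^ N := third_pow_le (by omega)
    · rw [div_eq_mul_inv, norm_mul, norm_mul, norm_mul, h360n, norm_pow, hPn]
      calc (1 / (3 : ℝ) ^ (2 * K)) ^ 2 * (‖w1 - w10‖ * ‖w1 + w10‖) * 9
          ≤ (1 / (3 : ℝ) ^ (2 * K)) ^ 2 * (1 / (3 : ℝ) ^ m * 1) * 9 := by gcongr
        _ = 1 / (3 : ℝ) ^ (4 * K + m - 2) := by
            have h1 : 4 * K + m - 2 + 2 = 4 * K + m := by omega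
            have : (3 : ℝ) ^ (4 * K + m) = (3 : ℝ) ^ (4 * K + m - 2) * 9 := by
              rw [show (9 : ℝ) = 3 ^ 2 by norm_num, ← pow_add, h1]
            rw [mul_one, div_pow, one_pow, ← pow_mul, show 2 * K * 2 = 4 * K by ring,
              show (1 : ℝ) / (3 : ℝ) ^ (4 * K) * (1 / (3 : ℝ) ^ m) = 1 / (3 : ℝ) ^ (4 * K + m) by
                rw [pow_add]; field_simp, this]
            field_simp
        _ ≤ 1 / (3 : ℝ) ^ N := third_pow_le (by omega)
  -- the model unit `λ²·S₂⁰·Π⁰ ≡ υ (mod 3^N)`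
  have hmodel : ‖(lam : ℚ_[3]) ^ 2 * S20 * Pr0 - ups‖ ≤ 1 / (3 : ℝ) ^ N := by
    have h360 : (360 : ℚ_[3]) ≠ 0 := by norm_num
    have hid : (lam : ℚ_[3]) ^ 2 * S20 * Pr0 - ups =
        ((((lam ^ 2 * (360 * Γ ^ 2 + 30 * 3 ^ (2 * K) * lam ^ 2 * Γ + 3 ^ (4 * K) * lam ^ 4) *
          (c4 ^ 3 * Γ - 2 * 3 ^ (2 * K) * D * lam ^ 2) - 360 * Γ ^ 3 * c4 ^ 3 * ups : ℤ)) : ℚ_[3])) *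
          ((360 : ℚ_[3]) * (Γ : ℚ_[3]) ^ 3 * (c4 : ℚ_[3]) ^ 3)⁻¹ := by
      rw [hS20, hPr0, hw10, ht, hP]
      push_cast
      field_simp
      ring
    rw [hid, norm_mul, norm_inv, norm_mul, norm_mul, norm_pow, norm_pow, hΓn, hc4n, one_pow, mul_one, mul_one,
      ← norm_inv, h360n]
    calc _ ≤ 1 / (3 : ℝ) ^ (N + 2) * 9 := by gcongr; exact norm_intCast_le_of_pow_dvd hups
      _ = 1 / (3 : ℝ) ^ N := by rw [pow_add]; field_simp; norm_num
  -- the cosh remainder `R`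
  set R : ℚ_[3] := c - 1 - w / 2 - w ^ 2 / 24 - w ^ 3 / 720 with hR
  have hRn : ‖R‖ ≤ 9 * ‖w‖ ^ 4 := hc3
  -- assembly: `Y − Pυ = P(Λ²S₂Π − υ) + 2·C2·R·Π`, using `C2·w = P·Λ²`
  have hCw : C2 * w = P * Λ ^ 2 := by rw [hw, hw1]; field_simp
  have hY : C2 * (2 * (c - 1) * Pr) - P * ups = P * (Λ ^ 2 * S2 * Pr - ups) + 2 * C2 * R * Pr := by
    have h2c : 2 * (c - 1) = w * S2 + 2 * R := by rw [hS2, hR]; field_simp; ring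
    rw [h2c]
    have : C2 * ((w * S2 + 2 * R) * Pr) = (C2 * w) * S2 * Pr + 2 * C2 * R * Pr := by ring
    rw [this, hCw]; ring
  rw [hY]
  have hmain : ‖Λ ^ 2 * S2 * Pr - ups‖ ≤ 1 / (3 : ℝ) ^ N := by
    have hid : Λ ^ 2 * S2 * Pr - ups = (Λ ^ 2 - (lam : ℚ_[3]) ^ 2) * S2 * Pr + (lam : ℚ_[3]) ^ 2 * (S2 - S20) * Pr +
        (lam : ℚ_[3]) ^ 2 * S20 * (Pr - Pr0) + ((lam : ℚ_[3]) ^ 2 * S20 * Pr0 - ups) := by ring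
    rw [hid]
    refine (IsUltrametricDist.norm_add_le_max _ _).trans (max_le ?_ hmodel)
    refine (IsUltrametricDist.norm_add_le_max _ _).trans (max_le ?_ ?_)
    · refine (IsUltrametricDist.norm_add_le_max _ _).trans (max_le ?_ ?_)
      · rw [norm_mul, norm_mul]
        calc ‖Λ ^ 2 - (lam : ℚ_[3]) ^ 2‖ * ‖S2‖ * ‖Pr‖ ≤ 1 / (3 : ℝ) ^ N * 1 * 1 := by gcongr
          _ = 1 / (3 : ℝ) ^ N := by ring
      · rw [norm_mul, norm_mul, norm_pow, hlamn, one_pow, one_mul]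
        calc ‖S2 - S20‖ * ‖Pr‖ ≤ 1 / (3 : ℝ) ^ N * 1 := by gcongr
          _ = 1 / (3 : ℝ) ^ N := mul_one _
    · rw [norm_mul, norm_mul, norm_pow, hlamn, one_pow, one_mul]
      calc ‖S20‖ * ‖Pr - Pr0‖ ≤ 1 * (1 / (3 : ℝ) ^ N) := by gcongr
        _ = 1 / (3 : ℝ) ^ N := one_mul _
  have htail : ‖2 * C2 * R * Pr‖ ≤ ‖P‖ / (3 : ℝ) ^ N := by
    rw [norm_mul, norm_mul, norm_mul, h2n, hCn, one_mul, one_mul, hPn]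
    calc ‖R‖ * ‖Pr‖ ≤ 9 * ‖w‖ ^ 4 * 1 := by gcongr
      _ = 9 * (1 / (3 : ℝ) ^ (2 * K)) ^ 4 := by rw [hwn, mul_one]
      _ = 1 / (3 : ℝ) ^ (8 * K - 2) := by
          have h1 : 8 * K - 2 + 2 = 8 * K := by omega
          have : (3 : ℝ) ^ (8 * K) = (3 : ℝ) ^ (8 * K - 2) * 9 := by
            rw [show (9 : ℝ) = 3 ^ 2 by norm_num, ← pow_add, h1]
          rw [div_pow, one_pow, ← pow_mul, show 2 * K * 4 = 8 * K by ring, this]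
          field_simp
      _ ≤ 1 / (3 : ℝ) ^ (2 * K + N) := third_pow_le (by omega)
      _ = 1 / (3 : ℝ) ^ (2 * K) / (3 : ℝ) ^ N := by rw [pow_add]; field_simp
  refine (IsUltrametricDist.norm_add_le_max _ _).trans (max_le ?_ htail)
  rw [norm_mul]
  calc ‖P‖ * ‖Λ ^ 2 * S2 * Pr - ups‖ ≤ ‖P‖ * (1 / (3 : ℝ) ^ N) := by gcongr
    _ = ‖P‖ / (3 : ℝ) ^ N := by ring

end Summit.BirchSwinnertonDyer.Rank1Residual.X11b.RegMult.KernelCert
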